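import Summits.Ventures.PercRepro.Night2GoodTwoD2ShapeB
import Summits.Ventures.PercRepro.Night2GoodTwoD2Lines

/-!
# night-2: the structure of a loading set at a distance-2 target

Fix a distance-2 target `S` (cell `(2, 1)`, at most one coloop off `K`) and THE coloop `c` of `S ∖ K`.  For every
covered lossy big pair `(B, z)` whose distance-2 targets contain `S` (a LOADING pair), with `Q = insert z B` and the
AXIS `R = (Q ∖ K) ∖ coloops (Q ∖ K)`:
* `c` is one of the three coloops of `Q ∖ K` (a point of `S ∖ K` off `Q` is spanned by `Q ∖ K`, of the same rank),
  so `Q ∖ K = R ∪ {wₐ, w_b, c}` and `S ∖ K = Q ∖ K ∪ {p₁, p₂}`;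
* `p₁` lies in the plane `clF (insert wₐ R)` and off `clF (insert w_b R)`, and `p₂` the other way round
  (rank intersection of the two thin hyperplanes through each);
* the points of `G ∖ K` off the hyperplane `clF (S.erase c)` lie in the plane `clF (insert c R)` (the covering:
  such a point is off the thin face of `c`, hence on the thin faces of `wₐ` and `w_b`, whose closures meet in
  that plane) — paper NIGHT-2-g30 §7.2 and §7.4.
-/

namespace PercRepro.Shadow

open PercRepro.ThmH PercRepro.PerFlat

variable {α : Type*} [DecidableEq α] {M : Matroid α} [M.Finite] {G : Finset α}

/-- A point of `S` off a subset `Q ⊆ S` of the same rank is not a coloop of `S`. -/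
theorem not_mem_coloops_of_not_mem_of_rkN_eq {Q S : Finset α} (hSg : S ⊆ gr M) (hQS : Q ⊆ S)
    (hr : rkN M Q = rkN M S) {x : α} (hxS : x ∈ S) (hxQ : x ∉ Q) : x ∉ coloops M S := by
  intro hx
  have hxcl : x ∈ clF M Q := mem_clF_of_rkN_eq hQS hSg hr hxS
  have hsub : Q ⊆ S.erase x := fun a ha => Finset.mem_erase.2 ⟨fun h => hxQ (h ▸ ha), hQS ha⟩
  exact (mem_coloops.1 hx).2 (clF_mono hsub hxcl)

/-- The rank of `R ∪ {u, v}` is at most `rk R + 2`. -/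
theorem rkN_union_pair_le {R : Finset α} (u v : α) : rkN M (R ∪ {u, v}) ≤ rkN M R + 2 := by
  have h1 := rkN_union_le_rkN_add_card (M := M) R {u, v}
  have h2 := Finset.card_le_two (a := u) (b := v)
  omega

/-- **The structure of a loading set at a distance-2 target.** -/
theorem loading_structure (hG : G ∈ flatsQ M (5 + 1)) (hd : (gr M \ G).card = 2)
    (hk : kColoops M G = 1) (hs : ∀ e ∈ gr M, ∀ f ∈ gr M, e ≠ f → rkN M {e, f} = 2)
    (hl : ∀ e ∈ gr M, M.Indep {e}) {S : Finset α} {c : α} (hc : c ∈ coloops M (S \ coloops M G))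
    (hc1 : (coloops M (S \ coloops M G)).card ≤ 1) {B : Finset α} (hB : B ∈ thinMembers M 5 G)
    (hbig : 5 ≤ (B \ coloops M G).card) {z : α} (hz : z ∈ G \ clF M B) (h : loss M 5 G B z ≠ 0)
    (hno : ¬ (gtPts M 5 G (insert z B)).Nonempty) (hS : S ∈ d2Targets M 5 G (insert z B))
    {R : Finset α} (hR : R = (insert z B \ coloops M G) \ coloops M (insert z B \ coloops M G)) :
    ∃ wa wb p1 p2 : α,
      coloops M (insert z B \ coloops M G) = {wa, wb, c} ∧
      insert z B \ coloops M G = R ∪ {wa, wb, c} ∧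
      S \ coloops M G = insert p1 (insert p2 (R ∪ {wa, wb, c})) ∧
      (S \ coloops M G).card = R.card + 5 ∧
      rkN M R = 2 ∧ 3 ≤ R.card ∧ R ⊆ G ∧
      wa ∉ R ∧ wb ∉ R ∧ c ∉ R ∧ wa ≠ wb ∧ wa ≠ c ∧ wb ≠ c ∧
      p1 ∉ R ∪ {wa, wb, c} ∧ p2 ∉ R ∪ {wa, wb, c} ∧ p1 ≠ p2 ∧
      wa ∈ G ∧ wb ∈ G ∧ c ∈ G ∧ p1 ∈ G ∧ p2 ∈ G ∧
      wa ∉ clF M (insert wb R) ∧ wb ∉ clF M (insert wa R) ∧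
      p1 ∈ clF M (insert wa R) ∧ p1 ∉ clF M (insert wb R) ∧
      p2 ∈ clF M (insert wb R) ∧ p2 ∉ clF M (insert wa R) ∧
      (G \ coloops M G) \ clF M (S.erase c) ⊆ clF M (insert c R) := by
  have hd' : (gr M \ G).card ≤ 5 := by omega
  have hGg : G ⊆ gr M := (mem_flatsQ.1 hG).1
  obtain ⟨R₁, wa, wb, wc, p1, p2, hcol, hR₁, hQK, hSK, hSG, hR2, hR3, hRG, hwaR, hwbR, hwcR, hab, hac, hbc,
    hp1, hp2, hp12, hp1G, hp2G, hwaG, hwbG, hwcG, hwaH, hwbH, hwcH, hp1a, hp1b, hp1c, hp2b, hp2a, hp2c⟩ :=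
    d2Target_shape' hG hd hk hs hl hB hbig hz h hno hS
  have hRR : R = R₁ := hR.trans hR₁.symm
  subst hRR
  -- ranks of the pieces
  have hRg : R ⊆ gr M := hRG.trans hGg
  have hwag : wa ∈ gr M := hGg hwaG
  have hwbg : wb ∈ gr M := hGg hwbG
  have hwcg : wc ∈ gr M := hGg hwcG
  have hXab : R ∪ {wa, wb} ⊆ gr M := Finset.union_subset hRg (by
    intro a ha
    rw [Finset.mem_insert, Finset.mem_singleton] at ha
    rcases ha with rfl | rfl
    exacts [hwag, hwbg])
  have hXac : R ∪ {wa, wc} ⊆ gr M := Finset.union_subset hRg (by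
    intro a ha
    rw [Finset.mem_insert, Finset.mem_singleton] at ha
    rcases ha with rfl | rfl
    exacts [hwag, hwcg])
  have hXbc : R ∪ {wb, wc} ⊆ gr M := Finset.union_subset hRg (by
    intro a ha
    rw [Finset.mem_insert, Finset.mem_singleton] at ha
    rcases ha with rfl | rfl
    exacts [hwbg, hwcg])
  have hzG : z ∈ G := (Finset.mem_sdiff.1 hz).1
  have hzcl : z ∉ clF M B := (Finset.mem_sdiff.1 hz).2
  have hBG : B ⊆ G := subset_G_of_mem_thinMembers hB
  have hQG : insert z B ⊆ G := Finset.insert_subset hzG hBG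
  have hKQ : coloops M G ⊆ insert z B :=
    (coloops_subset_of_mem_thinMembers hG hd' hB).trans (Finset.subset_insert _ _)
  have hrQ : rkN M (insert z B) = 6 := by
    rw [rkN_insert_of_notMem_clF (hGg hzG) hzcl, rkN_eq_five_of_mem_thinMembers hB]
  have hr5 : rkN M (R ∪ {wa, wb, wc}) = 5 := by
    have := rkN_eq_rkN_sdiff_add_one hG hk (S := insert z B) hQG (Finset.Subset.refl _) hKQ
    rw [← hQK]
    omega
  have hwacl : wa ∉ clF M R := fun h' => hwaH (clF_mono Finset.subset_union_left h')
  have hwbcl : wb ∉ clF M R := fun h' => hwbH (clF_mono Finset.subset_union_left h')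
  have hwccl : wc ∉ clF M R := fun h' => hwcH (clF_mono Finset.subset_union_left h')
  have hrZa : rkN M (insert wa R) = 3 := by rw [rkN_insert_of_notMem_clF hwag hwacl, hR2]
  have hrZb : rkN M (insert wb R) = 3 := by rw [rkN_insert_of_notMem_clF hwbg hwbcl, hR2]
  have hrZc : rkN M (insert wc R) = 3 := by rw [rkN_insert_of_notMem_clF hwcg hwccl, hR2]
  have htriple : ∀ {u v w : α}, R ∪ {u, v, w} ⊆ (R ∪ {u, w}) ∪ (R ∪ {u, v}) := by
    intro u v w a ha
    rw [Finset.mem_union, Finset.mem_insert, Finset.mem_insert, Finset.mem_singleton] at ha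
    rw [Finset.mem_union, Finset.mem_union, Finset.mem_union, Finset.mem_insert, Finset.mem_singleton,
      Finset.mem_insert, Finset.mem_singleton]
    rcases ha with h | rfl | rfl | rfl
    · exact Or.inl (Or.inl h)
    · exact Or.inl (Or.inr (Or.inl rfl))
    · exact Or.inr (Or.inr (Or.inr rfl))
    · exact Or.inl (Or.inr (Or.inr rfl))
  have hUac_ab : 5 ≤ rkN M ((R ∪ {wa, wc}) ∪ (R ∪ {wa, wb})) := by
    have := rkN_mono (M := M) (htriple (u := wa) (v := wb) (w := wc))
    omega
  have hUbc_ab : 5 ≤ rkN M ((R ∪ {wb, wc}) ∪ (R ∪ {wa, wb})) := by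
    have h1 : R ∪ {wa, wb, wc} ⊆ (R ∪ {wb, wc}) ∪ (R ∪ {wa, wb}) := by
      intro a ha
      rw [Finset.mem_union, Finset.mem_insert, Finset.mem_insert, Finset.mem_singleton] at ha
      rw [Finset.mem_union, Finset.mem_union, Finset.mem_union, Finset.mem_insert, Finset.mem_singleton,
        Finset.mem_insert, Finset.mem_singleton]
      rcases ha with h | rfl | rfl | rfl
      · exact Or.inl (Or.inl h)
      · exact Or.inr (Or.inr (Or.inl rfl))
      · exact Or.inl (Or.inr (Or.inl rfl))
      · exact Or.inl (Or.inr (Or.inr rfl))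
    have := rkN_mono (M := M) h1
    omega
  have hUbc_ac : 5 ≤ rkN M ((R ∪ {wb, wc}) ∪ (R ∪ {wa, wc})) := by
    have h1 : R ∪ {wa, wb, wc} ⊆ (R ∪ {wb, wc}) ∪ (R ∪ {wa, wc}) := by
      intro a ha
      rw [Finset.mem_union, Finset.mem_insert, Finset.mem_insert, Finset.mem_singleton] at ha
      rw [Finset.mem_union, Finset.mem_union, Finset.mem_union, Finset.mem_insert, Finset.mem_singleton,
        Finset.mem_insert, Finset.mem_singleton]
      rcases ha with h | rfl | rfl | rfl
      · exact Or.inl (Or.inl h)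
      · exact Or.inr (Or.inr (Or.inl rfl))
      · exact Or.inl (Or.inr (Or.inl rfl))
      · exact Or.inl (Or.inr (Or.inr rfl))
    have := rkN_mono (M := M) h1
    omega
  have hsub_a_ac : insert wa R ⊆ R ∪ {wa, wc} :=
    Finset.insert_subset_iff.2 ⟨by simp, Finset.subset_union_left⟩
  have hsub_a_ab : insert wa R ⊆ R ∪ {wa, wb} :=
    Finset.insert_subset_iff.2 ⟨by simp, Finset.subset_union_left⟩
  have hsub_b_bc : insert wb R ⊆ R ∪ {wb, wc} :=
    Finset.insert_subset_iff.2 ⟨by simp, Finset.subset_union_left⟩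
  have hsub_b_ab : insert wb R ⊆ R ∪ {wa, wb} :=
    Finset.insert_subset_iff.2 ⟨by simp, Finset.subset_union_left⟩
  have hsub_c_bc : insert wc R ⊆ R ∪ {wb, wc} :=
    Finset.insert_subset_iff.2 ⟨by simp, Finset.subset_union_left⟩
  have hsub_c_ac : insert wc R ⊆ R ∪ {wa, wc} :=
    Finset.insert_subset_iff.2 ⟨by simp, Finset.subset_union_left⟩
  -- `wc` is a coloop of `S ∖ K`, hence `wc = c`
  have hwcS : wc ∈ coloops M (S \ coloops M G) := by
    refine mem_coloops.2 ⟨by rw [hSK]; simp, fun hmem => hwcH ?_⟩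
    refine clF_subset_clF_of_subset_clF ?_ hmem
    intro x hx
    rw [Finset.mem_erase, hSK] at hx
    simp only [Finset.mem_insert, Finset.mem_union, Finset.mem_singleton] at hx
    rcases hx.2 with rfl | rfl | hR' | rfl | rfl | rfl
    · exact hp1c
    · exact hp2c
    · exact subset_clF_of_subset_gr hXab (Finset.mem_union_left _ hR')
    · exact subset_clF_of_subset_gr hXab (by simp)
    · exact subset_clF_of_subset_gr hXab (by simp)
    · exact absurd rfl hx.1
  obtain rfl : c = wc := Finset.card_le_one.1 hc1 c hc wc hwcS
  -- `Q ⊆ S`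
  have hQS : insert z B ⊆ S := by
    obtain ⟨p, -, hp⟩ := mem_d2Targets.1 hS
    rw [← hp]
    exact (Finset.subset_insert _ _).trans (Finset.subset_insert _ _)
  refine ⟨wa, wb, p1, p2, hcol, hQK, hSK, ?_, hR2, hR3, hRG, hwaR, hwbR, hwcR, hab, hac, hbc, hp1, hp2, hp12,
    hwaG, hwbG, hwcG, hp1G, hp2G, ?_, ?_, ?_, ?_, ?_, ?_, ?_⟩
  · rw [hSK]
    exact card_shape hwaR hwbR hwcR hab hac hbc hp1 hp2 hp12
  · exact fun h' => hwaH (clF_mono hsub_b_bc h')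
  · exact fun h' => hwbH (clF_mono hsub_a_ac h')
  · -- `p1 ∈ clF (insert wa R)`: rank intersection of `R ∪ {wa, wc}` and `R ∪ {wa, wb}`
    refine mem_clF_of_mem_clF_of_mem_clF hXac hXab hsub_a_ac hsub_a_ab ?_ hp1b hp1c
    rw [hrZa]
    have := rkN_union_pair_le (M := M) (R := R) wa c
    have := rkN_union_pair_le (M := M) (R := R) wa wb
    omega
  · exact fun h' => hp1a (clF_mono hsub_b_bc h')
  · refine mem_clF_of_mem_clF_of_mem_clF hXbc hXab hsub_b_bc hsub_b_ab ?_ hp2a hp2c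
    rw [hrZb]
    have := rkN_union_pair_le (M := M) (R := R) wb c
    have := rkN_union_pair_le (M := M) (R := R) wa wb
    omega
  · exact fun h' => hp2b (clF_mono hsub_a_ac h')
  · -- the covering: points of `G ∖ K` off `clF (S.erase c)` lie in the plane `clF (insert c R)`
    intro x hx
    rw [Finset.mem_sdiff, Finset.mem_sdiff] at hx
    obtain ⟨⟨hxG, hxK⟩, hxcl⟩ := hx
    have hZg : insert c R ⊆ gr M := Finset.insert_subset hwcg hRg
    by_cases hxQ : x ∈ insert z B
    · have hxQK : x ∈ R ∪ {wa, wb, c} := by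
        rw [← hQK]
        exact Finset.mem_sdiff.2 ⟨hxQ, hxK⟩
      by_cases hxc : x = c
      · subst hxc
        exact subset_clF_of_subset_gr hZg (Finset.mem_insert_self _ _)
      · exfalso
        apply hxcl
        apply subset_clF_of_subset_gr ((Finset.erase_subset _ _).trans (hSG.trans hGg))
        exact Finset.mem_erase.2 ⟨hxc, hQS hxQ⟩
    · have hxGQ : x ∈ G \ insert z B := Finset.mem_sdiff.2 ⟨hxG, hxQ⟩
      have hfaces := thinFacesOf_eq_image_erase hG hd hk hs hl hB hbig hz h
      have hface : ∀ v ∈ coloops M (insert z B \ coloops M G),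
          (insert z B).erase v ∈ thinFacesOf M 5 G (insert z B) := by
        intro v hv
        rw [hfaces]
        exact Finset.mem_image_of_mem _ hv
      have hcolmem : ∀ v, v ∈ ({wa, wb, c} : Finset α) → v ∈ coloops M (insert z B \ coloops M G) := by
        rw [hcol]
        exact fun v hv => hv
      have hmemQ : ∀ v, v ∈ ({wa, wb, c} : Finset α) → v ∈ insert z B := by
        intro v hv
        have : v ∈ R ∪ {wa, wb, c} := Finset.mem_union_right _ hv
        rw [← hQK] at this
        exact (Finset.mem_sdiff.1 this).1
      have herase_ne : ∀ v ∈ insert z B, ∀ u, v ≠ u → (insert z B).erase v ≠ (insert z B).erase u := by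
        intro v hv u hvu heq
        have hmem : v ∈ (insert z B).erase u := Finset.mem_erase.2 ⟨hvu, hv⟩
        rw [← heq] at hmem
        exact (Finset.mem_erase.1 hmem).1 rfl
      have hxFc : x ∉ clF M ((insert z B).erase c) :=
        fun h' => hxcl (clF_mono (Finset.erase_subset_erase _ hQS) h')
      have hxa : x ∈ clF M ((insert z B).erase wa) :=
        mem_clF_of_not_gtPts hG hd hk hs hl hB hbig hz h hno hxGQ (hface c (hcolmem c (by simp))) hxFc
          (hface wa (hcolmem wa (by simp))) (herase_ne wa (hmemQ wa (by simp)) c hac)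
      have hxb : x ∈ clF M ((insert z B).erase wb) :=
        mem_clF_of_not_gtPts hG hd hk hs hl hB hbig hz h hno hxGQ (hface c (hcolmem c (by simp))) hxFc
          (hface wb (hcolmem wb (by simp))) (herase_ne wb (hmemQ wb (by simp)) c hbc)
      -- transfer to the parts off `K`
      obtain ⟨e₀, he₀⟩ := Finset.card_eq_one.1 (show (coloops M G).card = 1 by
        rw [← kColoops_eq_card_coloops]; exact hk)
      have he₀c : e₀ ∈ coloops M G := he₀ ▸ Finset.mem_singleton_self e₀
      have hxe : x ≠ e₀ := fun h' => hxK (h' ▸ he₀c)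
      have hbridge : ∀ v, x ∈ clF M ((insert z B).erase v) →
          x ∈ clF M ((insert z B \ coloops M G).erase v) := by
        intro v hxv
        have h1 := mem_clF_erase_coloop_of_mem_clF hG he₀c ((Finset.erase_subset _ _).trans hQG) hxG hxe hxv
        have heq : ((insert z B).erase v).erase e₀ = (insert z B \ coloops M G).erase v := by
          rw [he₀, Finset.sdiff_singleton_eq_erase, Finset.erase_right_comm]
        rw [heq] at h1
        exact h1
      have hxa' : x ∈ clF M (R ∪ {wb, c}) :=
        clF_mono (fun a ha => erase_coloop_subset_aux hQK a ha) (hbridge wa hxa)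
      have hQKb : insert z B \ coloops M G = R ∪ {wb, wa, c} := hQK.trans triple_perm_aux
      have hxb' : x ∈ clF M (R ∪ {wa, c}) :=
        clF_mono (fun a ha => erase_coloop_subset_aux hQKb a ha) (hbridge wb hxb)
      refine mem_clF_of_mem_clF_of_mem_clF hXbc hXac hsub_c_bc hsub_c_ac ?_ hxa' hxb'
      rw [hrZc]
      have := rkN_union_pair_le (M := M) (R := R) wb c
      have := rkN_union_pair_le (M := M) (R := R) wa c
      omega

/-- **The points of `G ∖ K` off the hyperplane `clF (S.erase c)` number at least two**: besides the coloop `c` of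
`S ∖ K` there is another one, since `c` is not a coloop of `G`. -/
theorem exists_ne_of_mem_coloops_sdiff (hG : G ∈ flatsQ M (5 + 1)) (hk : kColoops M G = 1) {S : Finset α}
    (hSG : S ⊆ G) (hKS : coloops M G ⊆ S) {c : α} (hc : c ∈ coloops M (S \ coloops M G)) :
    ∃ c' ∈ (G \ coloops M G) \ clF M (S.erase c), c' ≠ c := by
  have hGg : G ⊆ gr M := (mem_flatsQ.1 hG).1
  have hcS : c ∈ coloops M S := mem_coloops_of_mem_coloops_sdiff hG hk hSG hc
  have hcSK : c ∈ S \ coloops M G := (mem_coloops.1 hc).1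
  have hcG : c ∈ G := hSG (Finset.mem_sdiff.1 hcSK).1
  have hcK : c ∉ coloops M G := (Finset.mem_sdiff.1 hcSK).2
  have hccl : c ∉ clF M (S.erase c) := (mem_coloops.1 hcS).2
  by_contra hcon
  push Not at hcon
  -- every point of `G` other than `c` lies in `clF (S.erase c)`
  have hsub : G.erase c ⊆ clF M (S.erase c) := by
    intro y hy
    rw [Finset.mem_erase] at hy
    by_cases hyK : y ∈ coloops M G
    · exact subset_clF_of_subset_gr ((Finset.erase_subset _ _).trans (hSG.trans hGg))
        (Finset.mem_erase.2 ⟨hy.1, hKS hyK⟩)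
    · by_contra hycl
      exact hy.1 (hcon y (Finset.mem_sdiff.2 ⟨Finset.mem_sdiff.2 ⟨hy.2, hyK⟩, hycl⟩))
  -- so `c ∈ clF (G.erase c) ⊆ clF (S.erase c)`, contradicting `c ∈ coloops S`
  have hcGcl : c ∈ clF M (G.erase c) := by
    by_contra hnot
    exact hcK (mem_coloops.2 ⟨hcG, hnot⟩)
  exact hccl (clF_subset_clF_of_subset_clF hsub hcGcl)

end PercRepro.Shadow
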